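import Literature.AlgebraicGeometry.HodgeTheory.HolomorphicBundleChernCharacter
import Literature.AlgebraicGeometry.HodgeTheory.HodgeModelConnected
import Literature.AlgebraicGeometry.HodgeTheory.HodgeFiltrationModels
import Literature.AlgebraicGeometry.Motives.ComplexPointsManifold
import Literature.Geometry.Kaehler.ManifoldFormsChart
import Literature.Geometry.Kaehler.ChernCharacterProofs
import Literature.Geometry.Kaehler.ConnectionExists
import HarnessLib

/-!
# Voisin I, Thm. 11.32 ⊗ ℂ in the extreme degrees (proofs): `p = 0` and `p > dim X`

Family `hodge`, layer `Literature/AlgebraicGeometry/HodgeTheory`. Sibling proof file of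
`HolomorphicBundleChernCharacter`, which states the named fact
`span_holomorphicBundleChernCharacter_eq_algebraicClasses` (C. Voisin, *Hodge Theory and Complex
Algebraic Geometry I* (2002), Thm. 11.32, tensored with `ℂ`: for `X` smooth projective and every
Hodge model `A`, `span_ℂ (holomorphicBundleChernCharacter A p) = algebraicClasses X p` in every
degree `2p`). That fact is NOT discharged here (its proof needs Chern–Weil theory for cocycle
bundles, GAGA, the cycle classes of Chern classes and locally free resolutions, none of which the
tree has). This file PROVES the two extreme ranges of degrees, where the statement is elementary,
and hence the whole statement for `dim X = 0`:

* `span_holomorphicBundleChernCharacter_zero` — **degree `0`**: `span_ℂ (ch₀ of holomorphic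
  bundles) = algebraicClasses X 0 = H⁰(X(ℂ); ℂ)`. Voisin, §11.3: `Hdg⁰(X)` is generated by the
  class of `X`, which is `ch₀(𝒪_X) = rank = 1` (Kobayashi (1987), Ch. II (1.10); in the tree
  `Connection.chernCharacterForm_zero`: `ch₀(E, D) = tr(1) = r`). Proof: `X(ℂ) ≅ M` is connected
  (SGA1 XII Prop. 2.4; the tree's `HodgeModel.connectedSpace_carrier`), so every closed smooth
  `0`-form on `M` is constant (`eq_const_of_isClosedForm_zero`, Warner (1983), 4.11) and
  `H⁰_dR(M; ℂ) = ℂ · [1]`; the comparison `A.deRham` and the pull-back `A.pullback` are linear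
  isomorphisms, and `[1] = ch₀` of the trivial holomorphic line bundle with its trivial connection.
* `span_holomorphicBundleChernCharacter_eq_algebraicClasses_of_lt` — **degrees `p > dim X`**:
  `H²ᵖ(X(ℂ); ℂ) = 0` (Hatcher, Thm. 3.26 (c) with Thm. 3.2, the tree's
  `Motives.ComplexPoints.subsingleton_singularCohomology_of_lt`), so both sides vanish.
* `span_holomorphicBundleChernCharacter_eq_algebraicClasses_of_dim_zero` — the fact for
  `X` of dimension `0` (a point), all `p`.

On the way, the degree-`0` de Rham lemma for the tree's manifold forms (`Geometry/Kaehler/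
ManifoldForms`, `ManifoldFormsChart`), stated for any real `C^∞` manifold charted on a normed
space `E` (model `𝓘(ℝ, E)`): a smooth closed `0`-form is locally constant
(`isLocallyConstant_of_isClosedForm_zero`: chart formula for `d` on the whole chart,
`inChart_mextDeriv_of_mem_target`; in degree `0`, `dθ = 0` forces `Dθ = 0`; mean value theorem on
a ball of the chart), hence constant on a connected manifold (`eq_const_of_isClosedForm_zero`), and
the `ℂ`-span `cclosedSmoothForms E M 0` consists of constants
(`exists_eq_const_of_mem_cclosedSmoothForms_zero`).

* **Non-vacuity of the Chern–Weil data** (appended): for every `C^∞` cocycle `V` on a Hodge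
  model and every `p`, `chernCharacterSet A V p` is non-empty
  (`HodgeModel.chernCharacterSet_nonempty`), and for every HOLOMORPHIC cocycle
  `holomorphicBundleChernCharacter A p` contains its `p`-th Chern character
  (`HodgeModel.holomorphicBundleChernCharacter_nonempty_of`): `V` carries a connection (partition
  of unity, Kobayashi–Nomizu I Thm. II.2.1 — the tree's PROVED `SmoothComplexVectorBundle.nonempty_connection`,
  `Geometry/Kaehler/ConnectionExists`), the
  local forms `ch_p(E, D)|_{U_i}` glue to a global smooth closed form (Kobayashi, Ch. II (2.4),
  (2.21) — PROVED in `Geometry/Kaehler/ChernCharacterProofs`,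
  `Connection.exists_isChernCharacterForm`), and its class has a preimage under the bijective
  pull-back `A.pullback`. So the left-hand side of the named fact ranges over genuine Chern–Weil
  classes of all holomorphic cocycles, in every degree.

What is NOT here: the degrees `1 ≤ p ≤ dim X` of Thm. 11.32 (the named fact stays a fact).

## References

* [VoisinHodgeI2002] C. Voisin, Hodge Theory and Complex Algebraic Geometry I (CUP 2002),
  Thm. 11.32 and §11.3 (p. 281–283 of the printed book).
* [Kobayashi1987] S. Kobayashi, Differential Geometry of Complex Vector Bundles (1987), Ch. II §1
  (1.10) (`ch₀ = rank`).
* [WarnerGTM94] F. W. Warner, Foundations of Differentiable Manifolds and Lie Groups (GTM 94),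
  4.11 (`H⁰_dR`).
* [HatcherAT2002] A. Hatcher, Algebraic Topology (2002), Thm. 3.26 (c), Thm. 3.2.
* [SGA1] A. Grothendieck, M. Raynaud, SGA 1, Exp. XII Prop. 2.4.
-/

noncomputable section

open scoped Manifold ContDiff Topology
open CategoryTheory Set Filter
open Literature.Geometry.Kaehler (SmoothComplexVectorBundle MForm IsSmoothForm IsClosedForm mextDeriv)
open Literature.NumberTheory.Transcendental (complexDeRhamCohomology mem_cclosedSmoothForms
  cclosedSmoothForms)

namespace Literature.AlgebraicGeometry.HodgeTheory

/-! ### Closed `0`-forms on a connected manifold are constant -/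

section DegreeZeroForms

variable {E : Type*} [NormedAddCommGroup E] [NormedSpace ℝ E]
  {M : Type*} [TopologicalSpace M] [ChartedSpace E M]
  {F : Type*} [NormedAddCommGroup F] [NormedSpace ℝ F]

/-- In degree `0` the alternatisation `Dθ ↦ dθ` is injective, pointwise: `dθ(y) = 0` forces
`Dθ(y) = 0` (the value of a `0`-form is its value on the empty tuple). [folklore] -/
theorem fderiv_eq_zero_of_extDeriv_apply_eq_zero {θ : E → E [⋀^Fin 0]→L[ℝ] F} {y : E}
    (h : extDeriv θ y = 0) : fderiv ℝ θ y = 0 := by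
  ext v u
  have h1 : extDeriv θ y (Matrix.vecCons v u) = 0 := by rw [h]; rfl
  rw [extDeriv, ContinuousAlternatingMap.alternatizeUncurryFin_apply, Fin.sum_univ_succ,
    Fin.sum_univ_zero, add_zero] at h1
  simp only [Fin.val_zero, pow_zero, one_smul, Matrix.cons_val_zero] at h1
  have hu : (0 : Fin 1).removeNth (Matrix.vecCons v u) = u := Subsingleton.elim _ _
  rw [hu] at h1
  rw [h1]
  rfl

variable [IsManifold 𝓘(ℝ, E) ∞ M]

/-- The chart representative of a `0`-form is the form read through the inverse chart:
`α.inChart x₀ y = α ((extChartAt x₀)⁻¹ y)` on the chart target. [folklore] -/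
theorem inChart_apply_of_degree_zero (α : MForm 𝓘(ℝ, E) M F 0) {x₀ : M} {y : E}
    (hy : y ∈ (extChartAt 𝓘(ℝ, E) x₀).target) :
    α.inChart x₀ y = α ((extChartAt 𝓘(ℝ, E) x₀).symm y) := by
  rw [α.inChart_eq_of_mem_target hy]
  ext v
  rw [ContinuousAlternatingMap.compContinuousLinearMap_apply]
  exact congrArg _ (Subsingleton.elim _ _)

/-- **A smooth closed `0`-form is locally constant**: in the chart at `x₀` its representative
has vanishing exterior derivative on the (open) chart target (chart formula for `d`,
`inChart_mextDeriv_of_mem_target`), hence vanishing derivative (degree `0`), hence is constant on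
a ball around the centre (mean value theorem); read back through the chart, `α` is constant
near `x₀`. Warner (1983), 4.11 (`H⁰_dR(M) = ℝ` for connected `M`). [cite: WarnerGTM94, 4.11] -/
theorem isLocallyConstant_of_isClosedForm_zero {α : MForm 𝓘(ℝ, E) M F 0} (hs : IsSmoothForm α)
    (hc : IsClosedForm α) : IsLocallyConstant (X := M) (Y := E [⋀^Fin 0]→L[ℝ] F) α := by
  refine (IsLocallyConstant.iff_eventually_eq (X := M) (Y := E [⋀^Fin 0]→L[ℝ] F) α).2
    fun x₀ ↦ ?_
  -- (1) the representative has zero exterior derivative on the chart target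
  have hd : ∀ y ∈ (extChartAt 𝓘(ℝ, E) x₀).target, extDeriv (α.inChart x₀) y = 0 := fun y hy ↦ by
    have h := Literature.Geometry.Kaehler.inChart_mextDeriv_of_mem_target α hy
      ((Literature.Geometry.Kaehler.isSmoothForm_iff_smoothAt α).1 hs _)
    have h0 : mextDeriv α = 0 := hc
    rw [h0, Literature.Geometry.Kaehler.MForm.inChart_zero, Pi.zero_apply,
      ModelWithCorners.range_eq_univ, extDerivWithin_univ] at h
    exact h.symm
  -- (2) the representative is differentiable on the chart target
  have hdiff : DifferentiableOn ℝ (α.inChart x₀) (extChartAt 𝓘(ℝ, E) x₀).target := fun y hy ↦ by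
    have hz : (extChartAt 𝓘(ℝ, E) x₀).symm y ∈ (extChartAt 𝓘(ℝ, E) x₀).source :=
      (extChartAt 𝓘(ℝ, E) x₀).map_target hy
    have h := Literature.Geometry.Kaehler.MForm.SmoothAt.contDiffWithinAt_inChart (I := 𝓘(ℝ, E))
      hz ((Literature.Geometry.Kaehler.isSmoothForm_iff_smoothAt α).1 hs _)
    rw [(extChartAt 𝓘(ℝ, E) x₀).right_inv hy, ModelWithCorners.range_eq_univ] at h
    exact (h.differentiableWithinAt (by simp)).mono (subset_univ _)
  -- (3) constancy on a ball inside the target around the centre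
  obtain ⟨r, hr, hball⟩ := Metric.isOpen_iff.1 (isOpen_extChartAt_target (I := 𝓘(ℝ, E)) x₀)
    (extChartAt 𝓘(ℝ, E) x₀ x₀) (mem_extChartAt_target x₀)
  have hconst : ∀ y ∈ Metric.ball (extChartAt 𝓘(ℝ, E) x₀ x₀) r,
      α.inChart x₀ y = α.inChart x₀ (extChartAt 𝓘(ℝ, E) x₀ x₀) := fun y hy ↦
    Metric.isOpen_ball.is_const_of_fderiv_eq_zero
      (convex_ball (extChartAt 𝓘(ℝ, E) x₀ x₀) r).isPreconnected (hdiff.mono hball)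
      (fun y' hy' ↦ fderiv_eq_zero_of_extDeriv_apply_eq_zero (hd y' (hball hy')))
      hy (Metric.mem_ball_self hr)
  -- (4) read back through the chart
  have hnhds : extChartAt 𝓘(ℝ, E) x₀ ⁻¹' Metric.ball (extChartAt 𝓘(ℝ, E) x₀ x₀) r ∩
      (extChartAt 𝓘(ℝ, E) x₀).source ∈ 𝓝 x₀ := by
    refine Filter.inter_mem ?_ (extChartAt_source_mem_nhds x₀)
    exact (continuousAt_extChartAt x₀).preimage_mem_nhds
      (Metric.isOpen_ball.mem_nhds (Metric.mem_ball_self hr))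
  filter_upwards [hnhds] with z hz
  have h1 := hconst (extChartAt 𝓘(ℝ, E) x₀ z) hz.1
  rw [inChart_apply_of_degree_zero α (hball hz.1),
    inChart_apply_of_degree_zero α (mem_extChartAt_target x₀),
    (extChartAt 𝓘(ℝ, E) x₀).left_inv hz.2, extChartAt_to_inv x₀] at h1
  exact h1

/-- **Closed `0`-forms on a connected manifold are constant** (`H⁰_dR(M) =` constants,
Warner 4.11): a smooth closed `0`-form is the constant `0`-form `MForm.const` of any of its
values. [cite: WarnerGTM94, 4.11] -/
theorem eq_const_of_isClosedForm_zero [PreconnectedSpace M] {α : MForm 𝓘(ℝ, E) M F 0}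
    (hs : IsSmoothForm α) (hc : IsClosedForm α) (x₀ : M) :
    α = MForm.const 𝓘(ℝ, E) M (α x₀ ![]) := by
  funext x
  have h : (α x : E [⋀^Fin 0]→L[ℝ] F) = α x₀ :=
    (isLocallyConstant_of_isClosedForm_zero hs hc).apply_eq_of_preconnectedSpace x x₀
  change (α x : E [⋀^Fin 0]→L[ℝ] F) =
    ContinuousAlternatingMap.constOfIsEmpty ℝ E (Fin 0) (α x₀ ![])
  rw [h]
  ext v
  change α x₀ v = α x₀ ![]
  exact congrArg (α x₀) (Subsingleton.elim _ _)

omit [IsManifold 𝓘(ℝ, E) ∞ M] in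
/-- The `ℂ`-span of the closed smooth complex `0`-forms on a connected manifold consists of
constant `0`-forms. [cite: WarnerGTM94, 4.11] -/
theorem exists_eq_const_of_mem_cclosedSmoothForms_zero {E : Type*} [NormedAddCommGroup E]
    [NormedSpace ℂ E] {M : Type*} [TopologicalSpace M] [ChartedSpace E M]
    [IsManifold 𝓘(ℝ, E) ∞ M] [PreconnectedSpace M] {β : MForm 𝓘(ℝ, E) M ℂ 0}
    (hβ : β ∈ cclosedSmoothForms E M 0) : ∃ a : ℂ, β = MForm.const 𝓘(ℝ, E) M a := by
  replace hβ : β ∈ Submodule.span ℂ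
      (Literature.Geometry.Kaehler.closedSmoothForms 𝓘(ℝ, E) M ℂ 0 : Set (MForm 𝓘(ℝ, E) M ℂ 0)) :=
    hβ
  induction hβ using Submodule.span_induction with
  | mem α hα =>
    obtain ⟨hs, hc⟩ := hα
    rcases isEmpty_or_nonempty M with hM | ⟨⟨x₀⟩⟩
    · exact ⟨0, funext fun x ↦ (IsEmpty.false x).elim⟩
    · exact ⟨α x₀ ![], eq_const_of_isClosedForm_zero hs hc x₀⟩
  | zero =>
    exact ⟨0, by funext x; ext v; simp [Literature.Geometry.Kaehler.MForm.const_apply]⟩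
  | add α α' _ _ h h' =>
    obtain ⟨a, rfl⟩ := h
    obtain ⟨a', rfl⟩ := h'
    exact ⟨a + a', by funext x; ext v; simp [Literature.Geometry.Kaehler.MForm.const_apply]⟩
  | smul z α _ h =>
    obtain ⟨a, rfl⟩ := h
    exact ⟨z * a, by funext x; ext v; simp [Literature.Geometry.Kaehler.MForm.const_apply]⟩

end DegreeZeroForms

/-! ### Thm. 11.32 ⊗ ℂ in the extreme degrees: `p = 0` and `p > dim X` -/

section HodgeTheory

open Literature.AlgebraicTopology.SingularHomology

variable {n : ℕ} {X : Motives.SchemeOver ℂ}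

/-- **`ch₀` of the trivial line bundle is the unit class.** A class `c ∈ H⁰(X(ℂ); ℂ)` whose
pull-back to the Hodge model is the comparison image of `[1] ∈ H⁰_dR(M; ℂ)` lies in
`holomorphicBundleChernCharacter A 0`: `ch₀(M × ℂ, D_triv) = tr(1) = 1` (Kobayashi (1.10):
`ch₀ = rank`). [cite: Kobayashi1987, Ch. II §1 (1.10)] -/
theorem mem_holomorphicBundleChernCharacter_zero_of_pullback_eq (A : HodgeModel n X)
    {c : complexBetti X (2 * 0)}
    (hc : A.pullback (2 * 0) c =
      A.deRham A.carrier (2 * 0) (complexDeRhamCohomology.mk A.model A.carrier (2 * 0)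
        ⟨MForm.const 𝓘(ℝ, A.model) A.carrier (1 : ℂ),
          mem_cclosedSmoothForms (Literature.NumberTheory.Transcendental.isSmoothForm_const 1)
            (Literature.NumberTheory.Transcendental.mextDeriv_const 1)⟩)) :
    c ∈ A.holomorphicBundleChernCharacter 0 := by
  refine A.chernCharacterSet_subset_holomorphicBundleChernCharacter
    (V := SmoothComplexVectorBundle.trivial A.model A.carrier 1)
    SmoothComplexVectorBundle.trivial_isHolomorphic 0 ?_
  refine ⟨SmoothComplexVectorBundle.Connection.trivial A.model A.carrier 1,
    MForm.const 𝓘(ℝ, A.model) A.carrier (1 : ℂ),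
    Literature.NumberTheory.Transcendental.isSmoothForm_const 1,
    Literature.NumberTheory.Transcendental.mextDeriv_const 1, fun i x _ ↦ ?_, hc⟩
  rw [SmoothComplexVectorBundle.Connection.chernCharacterForm_zero, one_nsmul]
  rfl

/-- **Voisin I, Thm. 11.32 ⊗ ℂ in degree `0` (proved).** For `X` smooth projective over `ℂ` and
any Hodge model `A`, the `ℂ`-span of the `0`-th Chern characters of the holomorphic vector bundles
on `X^an` is all of `algebraicClasses X 0 = H⁰(X(ℂ); ℂ)` (`Hdg⁰(X)` is generated by
`ch₀(𝒪) = 1 = [X]`): `M ≅ X(ℂ)` is connected (SGA1 XII 2.4, the tree's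
`HodgeModel.connectedSpace_carrier`), so `H⁰_dR(M; ℂ)` is spanned by `[1]` (closed `0`-forms are
constant, Warner 4.11), and the comparison `A.deRham` and the pull-back `A.pullback` are
isomorphisms. [cite: VoisinHodgeI2002, Thm. 11.32] [cite: Kobayashi1987, Ch. II §1 (1.10)]
[cite: WarnerGTM94, 4.11] -/
theorem span_holomorphicBundleChernCharacter_zero (hX : Motives.IsSmoothProjective n X)
    (A : HodgeModel n X) :
    Submodule.span ℂ (A.holomorphicBundleChernCharacter 0) = algebraicClasses X 0 := by
  rw [algebraicClasses_zero]
  refine eq_top_iff.2 fun c _ ↦ ?_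
  haveI := A.connectedSpace_carrier hX
  -- the unit class `c₁`
  obtain ⟨c₁, hc₁⟩ := A.pullback_surjective (2 * 0)
    (A.deRham A.carrier (2 * 0) (complexDeRhamCohomology.mk A.model A.carrier (2 * 0)
      ⟨MForm.const 𝓘(ℝ, A.model) A.carrier (1 : ℂ),
        mem_cclosedSmoothForms (Literature.NumberTheory.Transcendental.isSmoothForm_const 1)
          (Literature.NumberTheory.Transcendental.mextDeriv_const 1)⟩))
  have hmem : c₁ ∈ A.holomorphicBundleChernCharacter 0 :=
    mem_holomorphicBundleChernCharacter_zero_of_pullback_eq A hc₁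
  -- every class is a multiple of `c₁`
  obtain ⟨z, hz⟩ := (A.deRham A.carrier (2 * 0)).surjective (A.pullback (2 * 0) c)
  obtain ⟨β, rfl⟩ := complexDeRhamCohomology.mk_surjective z
  obtain ⟨a, ha⟩ := exists_eq_const_of_mem_cclosedSmoothForms_zero β.2
  have hβ : β = a • ⟨MForm.const 𝓘(ℝ, A.model) A.carrier (1 : ℂ),
      mem_cclosedSmoothForms (Literature.NumberTheory.Transcendental.isSmoothForm_const 1)
        (Literature.NumberTheory.Transcendental.mextDeriv_const 1)⟩ := Subtype.ext (by
    rw [Submodule.coe_smul, ha]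
    funext x
    ext v
    simp [Literature.Geometry.Kaehler.MForm.const_apply])
  have hca : c = a • c₁ :=
    A.pullback_injective (2 * 0) (by rw [map_smul, hc₁, ← hz, hβ, map_smul, map_smul])
  rw [hca]
  exact Submodule.smul_mem _ a (Submodule.subset_span hmem)

/-- **Thm. 11.32 ⊗ ℂ above the dimension (proved, trivially).** For `X` smooth projective of
dimension `n` and `p > n`, `H²ᵖ(X(ℂ); ℂ) = 0` (Hatcher Thm. 3.26(c) and Thm. 3.2 for the closed
`2n`-manifold `X(ℂ)`, the tree's `Motives.ComplexPoints.subsingleton_singularCohomology_of_lt`), so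
both sides vanish. [cite: HatcherAT2002, §3.3 Thm. 3.26(c)] [cite: VoisinHodgeI2002, Thm. 11.32] -/
theorem span_holomorphicBundleChernCharacter_eq_algebraicClasses_of_lt
    (hX : Motives.IsSmoothProjective n X) (A : HodgeModel n X) {p : ℕ} (hp : n < p) :
    Submodule.span ℂ (A.holomorphicBundleChernCharacter p) = algebraicClasses X p := by
  haveI : Subsingleton (complexBetti X (2 * p)) :=
    Motives.ComplexPoints.subsingleton_singularCohomology_of_lt hX ℂ (by omega)
  exact ((Submodule.subsingleton_iff ℂ).2 inferInstance).elim _ _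

/-- **Thm. 11.32 ⊗ ℂ for `X` of dimension `0` (proved):** for a smooth projective geometrically
irreducible `X` of dimension `0` the statement reduces to the degrees `p = 0`
(`span_holomorphicBundleChernCharacter_zero`) and `p > 0`
(`span_holomorphicBundleChernCharacter_eq_algebraicClasses_of_lt`).
[cite: VoisinHodgeI2002, Thm. 11.32] -/
theorem span_holomorphicBundleChernCharacter_eq_algebraicClasses_of_dim_zero
    (hX : Motives.IsSmoothProjective 0 X) (A : HodgeModel 0 X) (p : ℕ) :
    Submodule.span ℂ (A.holomorphicBundleChernCharacter p) = algebraicClasses X p := by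
  rcases Nat.eq_zero_or_pos p with rfl | hp
  · exact span_holomorphicBundleChernCharacter_zero hX A
  · exact span_holomorphicBundleChernCharacter_eq_algebraicClasses_of_lt hX A hp

/-! ### Non-vacuity of the Chern–Weil data -/

/-- **Every cocycle has Chern character classes.** For a `C^∞` cocycle `V` on a Hodge model `A`
and every `p`, the Chern character set `chernCharacterSet A V p` is non-empty: `V` carries a
connection `D` (partition of unity — the tree's PROVED `SmoothComplexVectorBundle.nonempty_connection`;
a Hodge model is Hausdorff, σ-compact, with finite-dimensional model), the local Chern character
forms `ch_p(E, D)|_{U_i} = (1/p!) tr((-Ω_i/2πi)ᵖ)` glue to a global smooth closed `2p`-form `θ`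
(Kobayashi, Ch. II (2.4) — the tree's PROVED `Connection.exists_isChernCharacterForm`), and the
class `A.deRham[θ]` has a preimage under the bijective pull-back `A.pullback`.
[cite: Kobayashi1987, Ch. I §2 and Ch. II §2 (2.4), (2.21)] -/
theorem HodgeModel.chernCharacterSet_nonempty (A : HodgeModel n X) {ι : Type} {r : ℕ}
    (V : SmoothComplexVectorBundle ι A.model A.carrier r) (p : ℕ) :
    (A.chernCharacterSet V p).Nonempty := by
  obtain ⟨D⟩ := V.nonempty_connection
  obtain ⟨θ, hs, hc, hch⟩ := D.exists_isChernCharacterForm p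
  obtain ⟨c, hc'⟩ := A.pullback_surjective (2 * p)
    (A.deRham A.carrier (2 * p) (complexDeRhamCohomology.mk A.model A.carrier (2 * p)
      ⟨θ, mem_cclosedSmoothForms hs hc⟩))
  exact ⟨c, D, θ, hs, hc, hch, hc'⟩

/-- Hence **every holomorphic cocycle on a Hodge model contributes to
`holomorphicBundleChernCharacter A p` in every degree `p`** (the set of `p`-th Chern characters of
holomorphic vector bundles on `X^an` is non-empty through any given holomorphic cocycle, not only
through the trivial bundle). [cite: Kobayashi1987, Ch. II §2 (2.4) and (2.21)] -/
theorem HodgeModel.holomorphicBundleChernCharacter_nonempty_of (A : HodgeModel n X) {ι : Type}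
    {r : ℕ} {V : SmoothComplexVectorBundle ι A.model A.carrier r} (hV : V.IsHolomorphic) (p : ℕ) :
    ∃ c ∈ A.holomorphicBundleChernCharacter p, c ∈ A.chernCharacterSet V p := by
  obtain ⟨c, hc⟩ := A.chernCharacterSet_nonempty V p
  exact ⟨c, A.chernCharacterSet_subset_holomorphicBundleChernCharacter hV p hc, hc⟩

end HodgeTheory

end Literature.AlgebraicGeometry.HodgeTheory

end
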